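import Summits.ResolutionOfSingularities.ResolutionOfSingularities.Theses.WildQuotients
import Summits.ResolutionOfSingularities.ResolutionOfSingularities.Theorems.WildQuotientsWildQuotientResolutionGluedSplitNormal
import Summits.ResolutionOfSingularities.ResolutionOfSingularities.Theorems.WildQuotientResolution.Negative.CounterexampleShape

/-!
# `WildQuotientResolution` — the first open case sits inside both the crux and the registered open stub (crux stmt-ResolutionOfSingularities-15640, line `Sketch`)

Support lemmas (dependency certificates, lead c6, 2026-08-17) for crux
`stmt-ResolutionOfSingularities-15640`
(`Summit.ResolutionOfSingularities.ResolutionOfSingularities.Theses.WildQuotients.WildQuotientResolution`,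
WQ) and its line `Cruxes/WildQuotientResolution/Lines/Sketch.lean` (skeleton v7: two registered open
stubs, `stub_phaseZeroHighDim` = PhaseZeroModel for `dim X′ ≥ 3`, and `stub_pClosedWQNormal` =
PClosedWQNormal, the p-closed sub-problem for the normal quotient itself).

The route's support item `CyclicQuotientFourfolds` (stmt-ResolutionOfSingularities-17941, "FIRST OPEN
CASE of WildQuotientResolution": `k` perfect, `Nat.card G = p`, `dim X₁ ≤ 4`) is typed as the body of
WQ with three extra hypotheses. This file records, sorry-free and BY NAME, that it is therefore a
literal consequence of

* the crux: `cyclicQuotientFourfolds_of_wildQuotientResolution`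
  (contrapositive `not_wildQuotientResolution_of_not_cyclicQuotientFourfolds`; and through
  `Negative.not_resolutionOfSingularities_of_not_wildQuotientResolution` also
  `not_resolutionOfSingularities_of_not_cyclicQuotientFourfolds` — a disproof of the first open case
  disproves resolution of singularities in characteristic `p`);
* the wild atom `CyclicWildQuotient` (stmt-15644, `Nat.card G = p`, every field, every dimension):
  `cyclicQuotientFourfolds_of_cyclicWildQuotient`;
* the REGISTERED OPEN STUB of the line: `cyclicQuotientFourfolds_of_pClosedWQNormal` — PClosedWQNormal
  (hypothesis `hWQn`, the v5/v7 signature of `stub_pClosedWQNormal` universally closed, verbatim)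
  proves `CyclicQuotientFourfolds`, via the landed chain PClosedWQNormal ⇒ PClosedWQ
  (`GluedSplitNormal.pClosedWQ_of_pClosedWQNormal`) ⇒ CyclicWildQuotient
  (`PClosedCase.cyclicWildQuotient_of_pClosedWQ`) ⇒ CyclicQuotientFourfolds.

Consequence for staffing (the point of the file): no proof of the registered stub
`stub_pClosedWQNormal`, hence no closing of line `Sketch`, and no proof of the crux by ANY line, can
exist before `CyclicQuotientFourfolds` (stmt-17941, open; `dim X₁ ≤ 3` known modulo
`CossartPiltant2019`, `Negative.wq_hasResolution_of_dim_le_three`) is proved. This file declares no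
definition and no declaration concludes a route decl unconditionally.

## Sources
* V. Cossart, O. Piltant, J. Algebra 529 (2019), Thm. 1.1 (named fact `CossartPiltant2019`: `dim ≤ 3`).
* F. Király, W. Lütkebohmert, Algebra & Number Theory 7 (2013), Thm. 2 (the cyclic wild criterion the
  route's game aims at); T. Yasuda, arXiv:2107.07073, §9 (non-linear wild `ℤ/p`-quotients as the
  place to look for a counterexample to resolution).
-/

noncomputable section

-- single-problem summit: the doubled namespace component `ResolutionOfSingularities` is forced
set_option linter.dupNamespace false

open CategoryTheory AlgebraicGeometry TopologicalSpace
open Literature.AlgebraicGeometry.Resolution Literature.AlgebraicGeometry.Ramification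
open Summit.ResolutionOfSingularities.ResolutionOfSingularities.Theses.WildQuotients

namespace Summit.ResolutionOfSingularities.ResolutionOfSingularities.Theorems.WildQuotientResolution.FirstOpenCase

/-! ## The first open case is a specialisation of the atom and of the crux -/

/-- **`CyclicWildQuotient ⇒ CyclicQuotientFourfolds`**: the dimension-`≤ 4`, perfect-field item
stmt-17941 is the wild atom stmt-15644 with two more hypotheses (`PerfectField k`,
`topologicalKrullDim X₁ ≤ 4`), which are simply forgotten. [folklore] -/
theorem cyclicQuotientFourfolds_of_cyclicWildQuotient (h : CyclicWildQuotient) :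
    CyclicQuotientFourfolds :=
  fun p hp k _ _ _ X' X₁ f q G _ _ ρ hcard hsep hft hqc hX₁ hX' hreg hq hsurj hU hρ horb _ =>
    h p hp k X' X₁ f q G ρ hcard hsep hft hqc hX₁ hX' hreg hq hsurj hU hρ horb

/-- **`WildQuotientResolution ⇒ CyclicQuotientFourfolds`**: the first open case is the crux with
three more hypotheses (`PerfectField k`, `Nat.card G = p`, `topologicalKrullDim X₁ ≤ 4`), all
forgotten. [folklore] -/
theorem cyclicQuotientFourfolds_of_wildQuotientResolution (h : WildQuotientResolution) :
    CyclicQuotientFourfolds :=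
  fun p hp k _ _ _ X' X₁ f q G _ _ ρ _ hsep hft hqc hX₁ hX' hreg hq hsurj hU hρ horb _ =>
    h p hp k X' X₁ f q G ρ hsep hft hqc hX₁ hX' hreg hq hsurj hU hρ horb

/-- **A disproof of the first open case disproves the crux** (contrapositive of
`cyclicQuotientFourfolds_of_wildQuotientResolution`). [folklore] -/
theorem not_wildQuotientResolution_of_not_cyclicQuotientFourfolds (h : ¬ CyclicQuotientFourfolds) :
    ¬ WildQuotientResolution :=
  fun hW => h (cyclicQuotientFourfolds_of_wildQuotientResolution hW)

/-- **A disproof of the first open case disproves the wild atom** `CyclicWildQuotient`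
(stmt-15644). [folklore] -/
theorem not_cyclicWildQuotient_of_not_cyclicQuotientFourfolds (h : ¬ CyclicQuotientFourfolds) :
    ¬ CyclicWildQuotient :=
  fun hC => h (cyclicQuotientFourfolds_of_cyclicWildQuotient hC)

/-- **A disproof of the first open case is a counterexample to resolution of singularities in
positive characteristic** (through `Negative.not_resolutionOfSingularities_of_not_wildQuotientResolution`:
the quotient `X₁` is a reduced separated finite-type `k`-scheme). [folklore] -/
theorem not_resolutionOfSingularities_of_not_cyclicQuotientFourfolds (h : ¬ CyclicQuotientFourfolds) :
    ¬ Literature.AlgebraicGeometry.Resolution.ResolutionOfSingularities :=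
  Negative.not_resolutionOfSingularities_of_not_wildQuotientResolution
    (not_wildQuotientResolution_of_not_cyclicQuotientFourfolds h)

/-! ## The registered open stub of line `Sketch` contains the first open case -/

/-- **PClosedWQNormal ⇒ CyclicQuotientFourfolds.** The hypothesis `hWQn` is the registered
signature of the open stub `stub_pClosedWQNormal` of `Cruxes/WildQuotientResolution/Lines/Sketch.lean`
(v5 = v7), universally closed, verbatim: the crux for FAITHFUL actions all of whose inertia groups
have a normal Sylow `p`-subgroup, onto a NORMAL `X₁` of positive dimension. It proves the first open
case: a group of order `p` is a `p`-group, so every inertia group is p-closed, and the three WLOG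
hypotheses are removed by the landed glue (`GluedSplitNormal.pClosedWQ_of_pClosedWQNormal`, then
`PClosedCase.cyclicWildQuotient_of_pClosedWQ`, then `cyclicQuotientFourfolds_of_cyclicWildQuotient`).
So the stub cannot be proved before stmt-17941 is. [folklore] -/
theorem cyclicQuotientFourfolds_of_pClosedWQNormal
    (hWQn : ∀ (p : ℕ) (_ : p.Prime) (k : Type) [Field k] [CharP k p] (X' X₁ : Scheme.{0})
      (f : X₁ ⟶ Spec (.of k)) (q : X' ⟶ X₁) (G : Type) [Group G] [Finite G] (ρ : G →* Aut X'),
      Function.Injective ρ → IsSeparated f → LocallyOfFiniteType f → QuasiCompact f →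
      IsIntegral X₁ → (∀ x : X₁, IsIntegrallyClosed (X₁.presheaf.stalk x)) →
      ¬ topologicalKrullDim X₁ ≤ 0 → IsIntegral X' → Scheme.IsRegular X' → IsFinite q →
      Function.Surjective q.base → (∃ U : X₁.Opens, Dense (U : Set X₁) ∧ Etale (q ∣_ U)) →
      (∀ g : G, (ρ g).hom ≫ q = q) →
      (∀ x y : X', q.base x = q.base y → ∃ g : G, (ρ g).hom.base x = y) →
      (∀ x : X', HasNormalSylow p (inertiaSubgroup ρ x)) → Scheme.HasResolution X₁) :
    CyclicQuotientFourfolds :=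
  cyclicQuotientFourfolds_of_cyclicWildQuotient
    (PClosedCase.cyclicWildQuotient_of_pClosedWQ fun p hp k _ _ X' X₁ f q G _ _ ρ =>
      GluedSplitNormal.pClosedWQ_of_pClosedWQNormal hWQn p hp k X' X₁ f q G ρ)

/-- **The crux also proves the first open case through the stub** (sanity link: WQ ⇒ PClosedWQ ⇒
PClosedWQNormal is forgetting hypotheses, `GluedSplitNormal.pClosedWQNormal_of_pClosedWQ`), so the
two routes to `CyclicQuotientFourfolds` recorded here agree. [folklore] -/
theorem cyclicQuotientFourfolds_of_wildQuotientResolution' (h : WildQuotientResolution) :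
    CyclicQuotientFourfolds :=
  cyclicQuotientFourfolds_of_pClosedWQNormal fun p hp k _ _ X' X₁ f q G _ _ ρ =>
    GluedSplitNormal.pClosedWQNormal_of_pClosedWQ
      (fun p hp k _ _ X' X₁ f q G _ _ ρ hsep hft hqc hX₁ hX' hreg hq hsurj hU hρ horb _ =>
        h p hp k X' X₁ f q G ρ hsep hft hqc hX₁ hX' hreg hq hsurj hU hρ horb)
      p hp k X' X₁ f q G ρ

end Summit.ResolutionOfSingularities.ResolutionOfSingularities.Theorems.WildQuotientResolution.FirstOpenCase

end
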